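import Mathlib.Data.Real.Basic
import Literature.Computability.Complexity.Mod2TseitinGadgetMatching
import Literature.Computability.Complexity.Mod2SystemEquiv
import Literature.Computability.MetaComplexity.ParityAlgSubstitution
import HarnessLib

/-!
# The Tseitin → `MOD2` gadget (Grigoriev 2001, Lemma 10), II: locality, the pointwise equations,
# and the reduction theorem

First, LOCALITY of the matching `M A` of a pattern `A` (`Mod2TseitinGadgetMatching.lean`):
whether an edge `s = {p, q}` lies in `M A` depends only on `A ∩ W₂ s`, `W₂ s = W p ∩ W q` the
common window of its endpoints (`mem_M_iff_of_inter_eq`; `|W₂ s| ≤` maximum degree — the degree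
bound "`4r`" of the substitution in Lemma 10), and the three families of `MOD2` equations hold
POINTWISE on patterns (`ind_mul_ind_eq_zero`, `sum_ind_eq`, `ind_Cov_inl`, `ind_Cov_inr`). Then:

We substitute the variables `X_s` (`s` a non-loop pair of points of `Pt G npad`) of `MOD2` by
`S s = cubeLift (W₂ s) (A ↦ [s ∈ M A]) ∈ ParityAlg` — the lift (`ParityAlgCubeLift.lean`) of the
indicator "the edge `s` is in the matching of the pattern `A`" over the window `W₂ s` of `s`
(`Mod2TseitinGadgetCover.lean`: the indicator is a `W₂ s`-junta) — and check the hypotheses of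
the substitution theorem `not_hasSOSRefutation_of_substitution` (`ParityAlgSubstitution.lean`,
the dual form of Grigoriev's Lemma 9) for the Tseitin XOR system `y_{star v} = -1` (`v : V`):

* every `S s` has monomials of size `≤ Δ` (maximum degree) (`cardSuppLE_S`);
* Boolean and disjointness equations of `MOD2` VANISH under the substitution
  (`aeval_system_edge`, `aeval_system_pair`: pointwise identities lifted by the algebra
  homomorphism `cubeLift`);
* the vertex equation of a padding point vanishes, and that of a gadget point of `v` becomes
  `(-1/2) · (1 + y_{star v}) · w` with `|w| ≤ Δ` (`aeval_system_vertex_inl`, via `cubeLift_even_inter`).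

Hence (`Mod2Gadget.not_hasSOSRefutation`): if the stars of `G` are `(r, c)`-expanding as parity
vectors (`VecExpands`), `r ≥ 2`, degrees `≤ Δ`, and `(2 d' + 2) Δ ≤ d ≤ c r / 2`, then `MOD2` on
the points `Pt G npad` — equivalently (`Mod2On.hasSOSRefutation_fin_iff`) Grigoriev's
`MOD2_N`, `N = |Pt G npad| = Σ_v (1 + 2 deg v) + 2 npad` — has no static sum-of-squares refutation
of half-degree `d'` (`Mod2Gadget.not_hasSOSRefutation_mod2`). This is Lemma 10 + Lemma 9 +
the Theorem of §2 of Grigoriev 2001 for an arbitrary expanding multigraph; the instantiation with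
an explicit expander family (Corollary 2) is `Mod2SosDegreeProof.lean`.

## References

* D. Grigoriev, *Linear lower bound on degrees of Positivstellensatz calculus proofs for the
  parity*, Theoret. Comput. Sci. 259 (2001) 613–622, §2 Theorem, Lemmas 9–10, Cor. 2.
  [Grigoriev2001TCS]
-/

noncomputable section

open Finset MvPolynomial
open Literature.Computability.MetaComplexity

namespace Literature.Computability.Complexity

namespace Mod2Gadget

section Window

variable {V : Type*} [DecidableEq V] {G : LGraph V} {npad : ℕ}

/-- The window of an edge: the Tseitin variables BOTH endpoints may depend on.
[cite: Grigoriev2001TCS, Lemma 10 (degree of the substitution)] -/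
def W₂ : Sym2 (Pt G npad) → Finset ℕ :=
  Sym2.lift ⟨fun p q => W p ∩ W q, fun _ _ => inter_comm _ _⟩

/-- Unfolding. [cite: Grigoriev2001TCS, Lemma 10] -/
@[simp] theorem W₂_mk (p q : Pt G npad) : W₂ s(p, q) = W p ∩ W q := rfl

/-- The window of an edge is contained in the window of each endpoint. [cite: Grigoriev2001TCS, Lemma 10] -/
theorem W₂_subset_of_mem {s : Sym2 (Pt G npad)} {p : Pt G npad} (hp : p ∈ s) : W₂ s ⊆ W p := by
  induction s using Sym2.ind with
  | h a b =>
    rw [W₂_mk]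
    rcases Sym2.mem_iff.1 hp with rfl | rfl
    · exact inter_subset_left
    · exact inter_subset_right

/-- Windows are stars or empty, hence small when degrees are. [cite: Grigoriev2001TCS, Lemma 10] -/
theorem card_W_le {Δ : ℕ} (hΔ : ∀ v, (G.star v).card ≤ Δ) (p : Pt G npad) : (W p).card ≤ Δ := by
  rcases p with ⟨v, o⟩ | x
  · exact hΔ v
  · simp

/-- … and so are edge windows. [cite: Grigoriev2001TCS, Lemma 10] -/
theorem card_W₂_le {Δ : ℕ} (hΔ : ∀ v, (G.star v).card ≤ Δ) (s : Sym2 (Pt G npad)) :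
    (W₂ s).card ≤ Δ := by
  induction s using Sym2.ind with
  | h a b => exact (card_le_card (W₂_subset_of_mem (Sym2.mem_mk_left a b))).trans (card_W_le hΔ a)

/-- The window of a cross edge contains its label. [cite: Grigoriev2001TCS, Lemma 10] -/
theorem mem_W₂_cedge (v : V) (e : ↥(G.star v)) : (e : ℕ) ∈ W₂ (cedge (npad := npad) v e) := by
  rw [cedge, W₂_mk, bpt, bpt, W_inl, W_inl, mem_inter]
  exact ⟨e.2, LGraph.mem_star_other e.2⟩

end Window

variable {V : Type*} [Fintype V] [DecidableEq V] {G : LGraph V} {npad : ℕ}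

/-! ### Locality -/

/-- A free point of the gadget of `v` is a point of that gadget. [cite: Grigoriev2001TCS, Lemma 10] -/
theorem exists_eq_inl_of_mem_free {v : V} {A : Finset ℕ} {p : Pt G npad} (hp : p ∈ free G npad v A) :
    ∃ o, p = Sum.inl ⟨v, o⟩ := by
  rcases p with ⟨w, o⟩ | x
  · obtain ⟨rfl, -⟩ := inl_mem_free_iff.1 hp
    exact ⟨o, rfl⟩
  · exact absurd hp inr_not_mem_free

/-- An edge of the local matching of `v` has window `star v`. [cite: Grigoriev2001TCS, Lemma 10] -/
theorem W₂_eq_of_mem_localM {v : V} {A : Finset ℕ} {s : Sym2 (Pt G npad)}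
    (hs : s ∈ localM G npad v A) : W₂ s = G.star v := by
  induction s using Sym2.ind with
  | h a b =>
    obtain ⟨oa, rfl⟩ := exists_eq_inl_of_mem_free (mem_free_of_mem_localM hs (Sym2.mem_mk_left a b))
    obtain ⟨ob, rfl⟩ := exists_eq_inl_of_mem_free (mem_free_of_mem_localM hs (Sym2.mem_mk_right _ b))
    rw [W₂_mk, W_inl, W_inl, inter_self]

/-- Patterns that agree on `star v` have the same local matching at `v`. [cite: Grigoriev2001TCS, Lemma 10] -/
theorem localM_congr {v : V} {A A' : Finset ℕ} (h : A ∩ G.star v = A' ∩ G.star v) :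
    localM G npad v A = localM G npad v A' := by
  rw [← localM_inter v A, h, localM_inter]

/-- Membership in `M A`, unfolded. [cite: Grigoriev2001TCS, Lemma 10] -/
theorem mem_M_iff {A : Finset ℕ} {s : Sym2 (Pt G npad)} :
    s ∈ M G npad A ↔ s ∈ padM G npad ∨ s ∈ crossM G npad A ∨ ∃ v, s ∈ localM G npad v A := by
  rw [M, mem_union, mem_union, mem_biUnion, or_assoc]
  simp only [mem_univ, true_and]

/-- One direction of locality. [cite: Grigoriev2001TCS, Lemma 10] -/
theorem mem_M_of_inter_eq {A A' : Finset ℕ} {s : Sym2 (Pt G npad)} (h : A ∩ W₂ s = A' ∩ W₂ s)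
    (hs : s ∈ M G npad A) : s ∈ M G npad A' := by
  rw [mem_M_iff] at hs ⊢
  rcases hs with hs | hs | ⟨v, hs⟩
  · exact Or.inl hs
  · obtain ⟨v, e, heA, rfl⟩ := mem_crossM.1 hs
    refine Or.inr (Or.inl (mem_crossM.2 ⟨v, e, ?_, rfl⟩))
    have : (e : ℕ) ∈ A ∩ W₂ (cedge (npad := npad) v e) := mem_inter.2 ⟨heA, mem_W₂_cedge v e⟩
    rw [h] at this
    exact (mem_inter.1 this).1
  · refine Or.inr (Or.inr ⟨v, ?_⟩)
    have hW := W₂_eq_of_mem_localM hs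
    rw [hW] at h
    rwa [← localM_congr h]

/-- **Locality of the gadget**: whether the edge `s` belongs to `M A` depends only on `A ∩ W₂ s`.
[cite: Grigoriev2001TCS, Lemma 10 (the substitution polynomials have degree ≤ 4r)] -/
theorem mem_M_iff_of_inter_eq {A A' : Finset ℕ} {s : Sym2 (Pt G npad)} (h : A ∩ W₂ s = A' ∩ W₂ s) :
    s ∈ M G npad A ↔ s ∈ M G npad A' :=
  ⟨mem_M_of_inter_eq h, mem_M_of_inter_eq h.symm⟩

/-- Locality, window form: for any `D ⊇ W₂ s`, `s ∈ M A ↔ s ∈ M (A ∩ D)`.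
[cite: Grigoriev2001TCS, Lemma 10] -/
theorem mem_M_iff_mem_M_inter {A D : Finset ℕ} {s : Sym2 (Pt G npad)} (hD : W₂ s ⊆ D) :
    s ∈ M G npad A ↔ s ∈ M G npad (A ∩ D) :=
  mem_M_iff_of_inter_eq (by rw [inter_assoc, inter_eq_right.2 hD])

/-! ### The `MOD2` equations pointwise -/

/-- **Disjointness pointwise**: two distinct edges through a common point are not both in the
matching `M A`. [cite: Grigoriev2001TCS, Lemma 10 (the equations X_e X_f = 0 of MOD2)] -/
theorem ind_mul_ind_eq_zero (A : Finset ℕ) {s₁ s₂ : Sym2 (Pt G npad)} (hne : s₁ ≠ s₂) {p : Pt G npad}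
    (h₁ : p ∈ s₁) (h₂ : p ∈ s₂) :
    (if s₁ ∈ M G npad A then (1 : ℝ) else 0) * (if s₂ ∈ M G npad A then 1 else 0) = 0 := by
  by_cases hs₁ : s₁ ∈ M G npad A
  · by_cases hs₂ : s₂ ∈ M G npad A
    · exact absurd ((isPMOn_M A).unique hs₁ hs₂ h₁ h₂) hne
    · rw [if_neg hs₂, mul_zero]
  · rw [if_neg hs₁, zero_mul]

/-- **Vertex equations pointwise**: the number of edges of `M A` through `p` (counted over the
non-loop pairs, i.e. the variables of `MOD2`) is `[p ∈ Cov A]`.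
[cite: Grigoriev2001TCS, Lemma 10 (the equations Σ_{e ∋ i} X_e = 1 of MOD2)] -/
theorem sum_ind_eq (A : Finset ℕ) (p : Pt G npad) :
    ∑ e ∈ univ.filter (fun e : {e : Sym2 (Pt G npad) // ¬ e.IsDiag} => p ∈ (e : Sym2 (Pt G npad))),
        (if (e : Sym2 (Pt G npad)) ∈ M G npad A then (1 : ℝ) else 0) =
      if p ∈ Cov G npad A then 1 else 0 := by
  rw [← sum_filter, filter_filter, sum_const, nsmul_eq_mul, mul_one]
  have key : ((univ.filter fun e : {e : Sym2 (Pt G npad) // ¬ e.IsDiag} =>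
      p ∈ (e : Sym2 (Pt G npad)) ∧ (e : Sym2 (Pt G npad)) ∈ M G npad A).image Subtype.val) =
      (M G npad A).filter fun e => p ∈ e := by
    ext s
    rw [mem_image, mem_filter]
    constructor
    · rintro ⟨e, he, rfl⟩
      obtain ⟨-, hp, hM⟩ := mem_filter.1 he
      exact ⟨hM, hp⟩
    · rintro ⟨hM, hp⟩
      exact ⟨⟨s, not_isDiag_of_mem_M hM⟩, mem_filter.2 ⟨mem_univ _, hp, hM⟩, rfl⟩
  rw [← card_image_of_injective _ Subtype.val_injective, key, (isPMOn_M A).card_filter_eq p]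
  split_ifs <;> simp

/-- The indicator of being cross-matched, for a gadget point with local part `o` at `v`:
`o = b_{v,e}` with `e ∈ A`. [cite: Grigoriev2001TCS, Lemma 10] -/
def crossInd (v : V) (o : Option (↥(G.star v) × Bool)) (A : Finset ℕ) : ℝ :=
  if ∃ e : ↥(G.star v), o = some (e, true) ∧ (e : ℕ) ∈ A then 1 else 0

omit [Fintype V] in
/-- `crossInd` depends only on `A ∩ star v`. [cite: Grigoriev2001TCS, Lemma 10] -/
theorem crossInd_inter (v : V) (o : Option (↥(G.star v) × Bool)) (A : Finset ℕ) :
    crossInd v o (A ∩ G.star v) = crossInd v o A := by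
  unfold crossInd
  congr 1
  refine propext (exists_congr fun e => and_congr_right fun _ => ?_)
  rw [mem_inter]
  exact ⟨fun h => h.1, fun h => ⟨h, e.2⟩⟩

/-- **Coverage of a gadget point** as a product: `[p ∈ Cov A] = 1 - [ |A ∩ star v| even ] · (1 - [p cross-matched])`.
[cite: Grigoriev2001TCS, Lemma 10] -/
theorem ind_Cov_inl (A : Finset ℕ) (v : V) (o : Option (↥(G.star v) × Bool)) :
    (if (Sum.inl ⟨v, o⟩ : Pt G npad) ∈ Cov G npad A then (1 : ℝ) else 0) =
      1 - (if Even (A ∩ G.star v).card then (1 : ℝ) else 0) * (1 - crossInd v o A) := by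
  unfold crossInd
  by_cases hev : Even (A ∩ G.star v).card
  · by_cases hc : ∃ e : ↥(G.star v), o = some (e, true) ∧ (e : ℕ) ∈ A
    · rw [if_pos hev, if_pos hc, if_pos]
      · ring
      · rw [inl_mem_Cov_iff]
        rintro ⟨-, h⟩
        obtain ⟨e, ho, he⟩ := hc
        exact h e ho he
    · rw [if_pos hev, if_neg hc, if_neg]
      · ring
      · rw [inl_mem_Cov_iff, not_not]
        refine ⟨hev, fun e ho he => hc ⟨e, ho, he⟩⟩
  · rw [if_neg hev, if_pos]
    · ring
    · rw [inl_mem_Cov_iff]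
      exact fun h => hev h.1

/-- **Coverage of a padding point**: always `1`. [cite: Grigoriev2001TCS, Lemma 10] -/
theorem ind_Cov_inr (A : Finset ℕ) (x : Fin npad × Bool) :
    (if (Sum.inr x : Pt G npad) ∈ Cov G npad A then (1 : ℝ) else 0) = 1 :=
  if_pos (inr_mem_Cov A x)



/-! ### The substitution -/

/-- The indicator set function "the edge `s` is in the matching of the pattern". [cite: Grigoriev2001TCS, Lemma 10] -/
def indM (G : LGraph V) (npad : ℕ) (s : Sym2 (Pt G npad)) : Finset ℕ → ℝ :=
  fun A => if s ∈ M G npad A then 1 else 0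

/-- `indM s` is a `W₂ s`-junta. [cite: Grigoriev2001TCS, Lemma 10] -/
theorem indM_inter (s : Sym2 (Pt G npad)) {D : Finset ℕ} (hD : W₂ s ⊆ D) (A : Finset ℕ) :
    indM G npad s A = indM G npad s (A ∩ D) := by
  unfold indM
  by_cases h : s ∈ M G npad A
  · rw [if_pos h, if_pos ((mem_M_iff_mem_M_inter hD).1 h)]
  · rw [if_neg h, if_neg fun h' => h ((mem_M_iff_mem_M_inter hD).2 h')]

/-- **The substitution** `X_s ↦ S s = cubeLift (W₂ s) [s ∈ M ·]`. [cite: Grigoriev2001TCS, Lemma 10 (the polynomials s_i)] -/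
def S (G : LGraph V) (npad : ℕ) (s : KEdgeOn (Pt G npad)) : ParityAlg :=
  cubeLift (W₂ (s : Sym2 (Pt G npad))) (indM G npad s)

/-- In the window of any endpoint the substitution is the lift of the same indicator.
[cite: Grigoriev2001TCS, Lemma 10] -/
theorem S_eq_cubeLift_W (s : KEdgeOn (Pt G npad)) {p : Pt G npad} (hp : p ∈ (s : Sym2 (Pt G npad))) :
    S G npad s = cubeLift (W p) (indM G npad s) :=
  (cubeLift_eq_of_subset (W₂_subset_of_mem hp) (indM_inter _ (subset_refl _))).symm

/-- **Degree of the substitution**: every monomial of `S s` has size `≤ Δ`.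
[cite: Grigoriev2001TCS, Lemma 10 ("(4r, 4r)-reducible")] -/
theorem cardSuppLE_S {Δ : ℕ} (hΔ : ∀ v, (G.star v).card ≤ Δ) (s : KEdgeOn (Pt G npad)) :
    CardSuppLE Δ (S G npad s) :=
  ((suppIn_cubeLift _ _).cardSuppLE).mono (card_W₂_le hΔ _)

/-! ### The three families of equations under the substitution -/

/-- Boolean equations vanish: `S_s² - S_s = 0`. [cite: Grigoriev2001TCS, Lemma 10] -/
theorem aeval_system_edge (s : KEdgeOn (Pt G npad)) :
    MvPolynomial.aeval (S G npad) (Mod2On.system (Pt G npad) (Sum.inl s)) = 0 := by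
  rw [Mod2On.system_edge, map_sub, map_pow, MvPolynomial.aeval_X, S, ← map_pow, ← map_sub]
  refine cubeLift_eq_zero fun A _ => ?_
  simp only [Pi.sub_apply, Pi.pow_apply, indM]
  split_ifs <;> norm_num

/-- Disjointness equations vanish: `S_s S_t = 0` for distinct `s, t` through a common point.
[cite: Grigoriev2001TCS, Lemma 10] -/
theorem aeval_system_pair
    (p : {p : KEdgeOn (Pt G npad) × KEdgeOn (Pt G npad) //
      p.1 ≠ p.2 ∧ ∃ i : Pt G npad, i ∈ (p.1 : Sym2 (Pt G npad)) ∧ i ∈ (p.2 : Sym2 (Pt G npad))}) :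
    MvPolynomial.aeval (S G npad) (Mod2On.system (Pt G npad) (Sum.inr (Sum.inl p))) = 0 := by
  obtain ⟨⟨s, t⟩, hne, i, hs, ht⟩ := p
  rw [Mod2On.system_pair, map_mul, MvPolynomial.aeval_X, MvPolynomial.aeval_X]
  dsimp only
  rw [S_eq_cubeLift_W s hs, S_eq_cubeLift_W t ht, ← map_mul]
  refine cubeLift_eq_zero fun A _ => ?_
  rw [Pi.mul_apply]
  exact ind_mul_ind_eq_zero A (fun h => hne (Subtype.ext h)) hs ht

/-- The vertex equation of `p` under the substitution is the lift, in the window of `p`, of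
`A ↦ [p ∈ Cov A] - 1`. [cite: Grigoriev2001TCS, Lemma 10] -/
theorem aeval_system_vertex (p : Pt G npad) :
    MvPolynomial.aeval (S G npad) (Mod2On.system (Pt G npad) (Sum.inr (Sum.inr p))) =
      cubeLift (W p) (fun A => (if p ∈ Cov G npad A then (1 : ℝ) else 0) - 1) := by
  rw [Mod2On.system_vertex, map_sub, map_sum, map_one]
  have h1 : ∑ s ∈ univ.filter (fun s : KEdgeOn (Pt G npad) => p ∈ (s : Sym2 (Pt G npad))),
      MvPolynomial.aeval (S G npad) (X s : MvPolynomial (KEdgeOn (Pt G npad)) ℝ) =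
      cubeLift (W p) (∑ s ∈ univ.filter (fun s : KEdgeOn (Pt G npad) => p ∈ (s : Sym2 (Pt G npad))),
        indM G npad s) := by
    rw [map_sum]
    refine sum_congr rfl fun s hs => ?_
    rw [MvPolynomial.aeval_X]
    exact S_eq_cubeLift_W s (mem_filter.1 hs).2
  rw [h1, ← map_one (cubeLift (W p)), ← map_sub]
  refine cubeLift_congr fun A _ => ?_
  rw [Pi.sub_apply, Finset.sum_apply, Pi.one_apply, ← sum_ind_eq A p]
  rfl

/-- The vertex equation of a padding point vanishes. [cite: Grigoriev2001TCS, Lemma 10] -/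
theorem aeval_system_vertex_inr (x : Fin npad × Bool) :
    MvPolynomial.aeval (S G npad) (Mod2On.system (Pt G npad) (Sum.inr (Sum.inr (Sum.inr x)))) = 0 := by
  rw [aeval_system_vertex]
  refine cubeLift_eq_zero fun A _ => ?_
  rw [ind_Cov_inr, sub_self]

/-- **The vertex equation of a gadget point of `v`** becomes `(-1/2) · (1 + y_{star v}) · w`, with
`w` the lift over `star v` of `1 - [cross-matched]`. [cite: Grigoriev2001TCS, Lemma 10 (the Tseitin equation of v inside the reduction)] -/
theorem aeval_system_vertex_inl (v : V) (o : Option (↥(G.star v) × Bool)) :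
    MvPolynomial.aeval (S G npad) (Mod2On.system (Pt G npad) (Sum.inr (Sum.inr (Sum.inl ⟨v, o⟩)))) =
      (-1 / 2 : ℝ) • ((1 + yMon (indVec (G.star v))) *
        cubeLift (G.star v) (fun A => 1 - crossInd v o A)) := by
  rw [aeval_system_vertex, W_inl]
  have h : (fun A => (if (Sum.inl ⟨v, o⟩ : Pt G npad) ∈ Cov G npad A then (1 : ℝ) else 0) - 1) =
      -((fun A => if Even (A ∩ G.star v).card then (1 : ℝ) else 0) *
        (fun A => 1 - crossInd v o A)) := by
    funext A
    rw [ind_Cov_inl, Pi.neg_apply, Pi.mul_apply]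
    ring
  rw [h, map_neg, map_mul, cubeLift_even_inter, smul_mul_assoc, ← neg_smul]
  norm_num

omit [Fintype V] in
/-- The cofactor `w` has monomials of size `≤ |star v|`. [cite: Grigoriev2001TCS, Lemma 10] -/
theorem cardSuppLE_w (v : V) (o : Option (↥(G.star v) × Bool)) :
    CardSuppLE (G.star v).card (cubeLift (G.star v) (fun A => 1 - crossInd v o A)) :=
  (suppIn_cubeLift _ _).cardSuppLE

/-! ### The reduction theorem -/

/-- **Grigoriev 2001, Lemma 10 + Lemma 9 + §2 Theorem, for an arbitrary expanding multigraph.**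
If the stars of the loop-free multigraph `G` are `(r, c)`-expanding as parity vectors, `c > 0`,
`r ≥ 2`, all degrees are `≤ Δ`, and `(2 d' + 2) Δ ≤ d ≤ c r / 2`, then `MOD2` on the points of the
reduction (vertex gadgets plus `npad` padding pairs) has no static sum-of-squares refutation of
half-degree `d'`: the substituted Grigoriev–Schoenebeck moment functional of the Tseitin system
`y_{star v} = -1` is a degree-`2d'` pseudoexpectation for it. [cite: Grigoriev2001TCS, Lemma 10] -/
theorem not_hasSOSRefutation {r c : ℝ} {Δ d d' : ℕ}
    (hexp : VecExpands (fun v : V => indVec (G.star v)) r c) (hc : 0 < c) (hr : 2 ≤ r)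
    (hΔ : ∀ v, (G.star v).card ≤ Δ) (hd : (d : ℝ) ≤ c * r / 2) (hd' : (2 * d' + 2) * Δ ≤ d) :
    ¬ HasSOSRefutation (Mod2On.system (Pt G npad)) d' := by
  refine not_hasSOSRefutation_of_substitution (g := fun v : V => indVec (G.star v))
    (b := fun _ => (-1 : ℝ)) (r := r) (d := d) (S := S G npad) (Mod2On.system (Pt G npad)) d'
    hexp hc hd hr (fun _ => by norm_num) (cardSuppLE_S hΔ) ?_ ?_
  · have : 2 * (Δ * d') = 2 * d' * Δ := by ring
    rw [this]
    exact le_trans (Nat.mul_le_mul_right _ (Nat.le_add_right _ _)) hd'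
  · rintro (s | q | p)
    · exact Or.inl (aeval_system_edge s)
    · exact Or.inl (aeval_system_pair q)
    · rcases p with ⟨v, o⟩ | x
      · refine Or.inr ⟨v, G.star v, -1 / 2, _, (G.star v).card, rfl, rfl, cardSuppLE_w v o,
          aeval_system_vertex_inl v o, ?_⟩
        calc (G.star v).card + Δ * (2 * d') + (G.star v).card
            ≤ Δ + Δ * (2 * d') + Δ := by gcongr <;> exact hΔ v
          _ = (2 * d' + 2) * Δ := by ring
          _ ≤ d := hd'
      · exact Or.inl (aeval_system_vertex_inr x)

/-- **The same for Grigoriev's `MOD2_N`**, `N = |Pt G npad| = Σ_v (1 + 2 deg v) + 2 npad`.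
[cite: Grigoriev2001TCS, Lemma 10 and Cor. 2] -/
theorem not_hasSOSRefutation_mod2 {r c : ℝ} {Δ d d' : ℕ}
    (hexp : VecExpands (fun v : V => indVec (G.star v)) r c) (hc : 0 < c) (hr : 2 ≤ r)
    (hΔ : ∀ v, (G.star v).card ≤ Δ) (hd : (d : ℝ) ≤ c * r / 2) (hd' : (2 * d' + 2) * Δ ≤ d) :
    ¬ HasSOSRefutation (Mod2.system (Fintype.card (Pt G npad))) d' := by
  rw [Mod2On.hasSOSRefutation_fin_iff]
  exact not_hasSOSRefutation hexp hc hr hΔ hd hd'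

end Mod2Gadget

end Literature.Computability.Complexity
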